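import Summits.BirchSwinnertonDyer.BirchSwinnertonDyer.Theorems.PrintCFramBottomClassIndexLawFiveLeGenusInternalIndexHalves
import Summits.BirchSwinnertonDyer.BirchSwinnertonDyer.Theorems.PrintCFramBottomClassIndexLawFiveLeKrizLiLocusOfPrintsFour
import Summits.BirchSwinnertonDyer.BirchSwinnertonDyer.Theorems.PrintCFramBottomClassIndexLawFiveLeKrizLiLocusLValueFree
import Summits.BirchSwinnertonDyer.BirchSwinnertonDyer.Theorems.EisensteinPrimesMazurMCOnCellBTwistbackDefectSwapUp
import Summits.BirchSwinnertonDyer.Rank1Residual.X11b.TwistTransportTam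
import HarnessLib

/-!
# Crux `PrintCFram.BottomClassIndexLawFiveLe` (stmt-BirchSwinnertonDyer-20372), line `eisenstein-resource-bdp-line` (registry v25):
# THE ORIENTED KERNEL OF THE GENUS-INTERNAL BRANCH — `BSD_p` OF THE RANK-ONE TWIST FROM A KRIZ–LI DATUM OF THE STRIPPED
# (RANK-ZERO) CURVE, general `p`, Manin-robust

Cell `bsd-print-cfram`, width seat `bsd-line-cfram-p1-w7` (g7); `--supports stmt-BirchSwinnertonDyer-20372` (helper). THEOREMS ONLY;
no definition, no named fact, no `sorry`. BSD is not proved by any of this; no summit statement is proved by this seat; the crux stays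
OPEN and no registered stub is closed (a reshape is the LEAD's).

WHAT THIS FILE IS. Ideator bsd-idea-7 g19's crux idea `Ideas/genus-internal-heegner-fields.md` (critic idea-crit-10 g5 V#146
PASS-WITH-PRICE, V#146b) replaces, for a rank-one class member `W = V^{(d_K)}`, the registry's search for a Heegner field of `W`
(every `q ∣ N_W` split) by the Heegner field `K` of a STRIPPED curve `V` of smaller conductor (`K` ramifies inside `N_W`): Kriz–Li's
Thm. 1.20 is applied to `(V, K)`, whose Heegner point carries the rank of `W`, not of `V`. The registry's Kriz–Li locus kernel
(`RegularLocus.bsdp_cmRamified_of_regularKrizLiDatum`, LEAD g5; `KrizLiLocusOfPrintsFour`, w7 g2) is ORIENTED: the curve with the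
Heegner datum is the rank-ONE curve and its twist by `d_K` the rank-ZERO partner. V#146b names «the ONE piece of new Lean this branch
owes»: the display / Heegner-index identity over `K` in the SWAPPED orientation. This file supplies it, for every `p`, WITHOUT a Manin
hypothesis and without any new socket:

* (file 1, `…GenusInternalIndexHalves`) `additiveControl_heegner_of_cmRamified'`, `indexHalves_cmRamified_of_regularKrizLiDatum'` —
  LEAD g3/g5's exact control and two index halves at slack `v_p(c)` VERBATIM, minus the binder `L(W^{(d_K)},1) ≠ 0`, which their
  proofs never use (it only fixed the orientation); so they apply to a datum curve `V` of analytic rank ZERO whose twist carries the rank.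
* §1 `displaySwap_of_indexHalves_manin` — bsd-eis's class-agnostic `…TwistbackDisplay.displaySwap_of_indexIdentityAt` with its inputs
  «`X11b.IndexIdentityAt` ∧ `p ∤ c(Dt)`» REPLACED by the two index halves at slack `v_p(c)`: the parametrisation constant cancels
  against the `−2·v_p(c)` of `TwistIdentity.padicValRat_add_eq_of_grossZagier_swap` (CGLS (5.6), ranks exchanged, Manin constant
  kept), so no Manin hypothesis is needed at the additive prime (where none is available: Česnavičius–Neururer–Saha).
* §2 **`bsdp_twist_of_strippedKrizLiDatum_of_prints`** — the FOUR refereed print facts of `stub_prints5`'s first conjunct (Hsieh 2014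
  Thm. A, Liu–Zhang–Zhang 2018, `ToricPublishedInputs`, Burungale–Flach 2024 Cor. 2) and Kriz–Li 2019 Thm. 1.20 give, for `V/ℚ`
  globally minimal with CM, `CMRamified V p`, `p ≥ 5`, a Heegner datum `(N = N_V, K, Dt, H, ι, P)` with `d_K < −4` (any parity), Kriz–Li's
  block `(ψ, ω, (1), (3), trace form; ε_K, (4))` AT `(V, K)`, and ANY globally minimal `W ≅ V^{(d_K)}` with `W.analyticRank = 1`:
  **`BSDp W p`**. Proof: `P` is non-torsion (Kriz–Li, `KrizLiLValueFree.not_isOfFinAddOrder_of_thm120`), hence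
  `L(V,1)·L′(W,1) = L′(V/K,1) ≠ 0` and `r_an(V) = 0`; a regular frame (`KrizLiLocusOfPrintsFour.exists_regular_of_krizLiBlock`,
  rank- and orientation-free); file 1's two halves at `(V, K)`; `BSDp V p` (rank zero, CM: Burungale–Flach); §1's display; bsd-eis's
  `…TwistbackDefectSwapUp.bsdp_twist_of_displaySwap_of_bsdp_rankZero`.

At `p = 7`, `V = cm7 ∼ X₀(49)`, `K = ℚ(√e*)` with `(e*/7) = +1`, the block is `ψ = ω²` and (4) is `reg(e)·B_{1,ω}` (V#146 (ii); the
entry lemma is w6 g8's P1) — the branch `stub_twistingFieldSeven` of the card's Transfer §; for `p ≡ 3 (8)` it serves the proper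
strippings `D ∣ e*`. CONDITIONAL on the named facts displayed as hypotheses; beyond-print theorem: NO (Gross–Zagier bookkeeping over
landed kernels). References: [KrizLi2019] Thm. 1.20, Rem. 1.21; [CastellaGrossiLeeSkinner2022] proof of Thm. 5.3.1, (5.5)–(5.7);
[GrossZagier1986] I.(6.3), (7.3), V.§2; [JetchevSkinnerWan2017] §7.4.1; [BurungaleFlach2024] Cor. 2; [Miller2011LMS] Def. 1.1;
Česnavičius–Neururer–Saha, *The Manin constant and the modular degree* (why `p ∤ c` is not assumed at an additive prime).
-/

set_option autoImplicit false
-- the summit namespace `Summit.BirchSwinnertonDyer.BirchSwinnertonDyer` repeats the problem name by design (D-0017)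
set_option linter.dupNamespace false

noncomputable section

open scoped Classical

namespace Summit.BirchSwinnertonDyer.BirchSwinnertonDyer.Theorems.PrintCFram.GenusInternal

/-! ## §1 The swapped display from the two index halves, Manin-robust (bsd-eis's §1 with the identity and `p ∤ c` replaced) -/

section Display

open scoped MatrixGroups ModularForm

open CongruenceSubgroup WeierstrassCurve NumberField
  Literature.NumberTheory.EllipticCurves
  Literature.NumberTheory.EllipticCurves.ModularForms
  Literature.NumberTheory.QuadraticFields
  Literature.NumberTheory.EllipticCurves.KrizLi2019
  Literature.NumberTheory.EllipticCurves.Rank1Residual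
  Literature.NumberTheory.EllipticCurves.Rank1Residual.Typed
  Literature.NumberTheory.EllipticCurves.Wuthrich2014
  Literature.NumberTheory.EllipticCurves.SteinWuthrich2013
  Literature.NumberTheory.EllipticCurves.GreenbergVatsal2000
  Summit.BirchSwinnertonDyer.Rank1Residual
  Summit.BirchSwinnertonDyer.BirchSwinnertonDyer.Theses
  Summit.BirchSwinnertonDyer.BirchSwinnertonDyer.Theorems.Rank1ResidualX1RankZeroTwist
  Summit.BirchSwinnertonDyer.BirchSwinnertonDyer.Theorems.SchneiderFree

/-- **The rank-zero display at one Heegner datum from the two index halves at slack `v_p(c)` — NO Manin hypothesis.** Data: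
`W/ℚ` globally minimal of conductor `N`, `ord_{s=1} L(E,s) = 0`, `p ≥ 5`; `K` imaginary quadratic, `d_K < -4` of EITHER parity, Heegner
hypothesis for `N`, `p` split; `Dt` a parametrisation datum of level `N` (ANY constant `c = Dt.c`), `H` a Heegner datum, `P ∈ E(K)`
its Heegner point; `Wd` a globally minimal model of `E^{(d_K)}` with `ord_{s=1} L = 1`; `q = L(E,1)/Ω_E`, `q_d = L'(Wd,1)/(Ω·Reg)`.
Inputs by name: Gross–Zagier (`hGZ`), Kolyvagin (`hKo`), GZK, modularity. If BOTH index halves hold at slack `v_p(c)` —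
`SchneiderFree.IndexLowerBoundLeAt W p K P (v_p c)` and `SchneiderFree.Upper.IndexUpperBoundLeAt W p K P (v_p c)`, i.e.
`2·ord_p[E(K):ℤP] = ord_p #Ш(E/K) + 2·ord_p ∏c_ℓ(E) + 2·v_p(c)` — then
`ord_p q − (ord_p #Ш(E) + ord_p ∏c(E) − 2 ord_p #E(ℚ)_tors) = −(ord_p q_d − (ord_p #Ш(Wd) + ord_p ∏c(Wd) − 2 ord_p #Wd(ℚ)_tors))`.
Proof: bsd-eis's `displaySwap_of_indexIdentityAt` verbatim, with `TwistIdentity.padicValRat_add_eq_of_grossZagier_swap`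
(`ord_p q + ord_p q_d = 2 ord_p I − 2 v_p(c) − 2 ord_p #E(K)_tors`, Manin constant KEPT) — the two `2·v_p(c)` cancel — and the odd
parts under `K/ℚ` of `Ш`, torsion and Tamagawa numbers, the last by the parity-free transport
`X11b.padicValNat_tamagawaProduct_twist_of_heegner` (`p ≥ 5`; pointer: w3 g16's tree check of V#146b (2)), so `d_K` may be even.
[cite: CastellaGrossiLeeSkinner2022, proof of Thm. 5.3.1, (5.5)–(5.7)]
[cite: GrossZagier1986, I.(6.5) and V.§2 (pp. 310–312)] [cite: JetchevSkinnerWan2017, §7.4.1 (arXiv:1512.06894 p. 30)]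
(Česnavičius–Neururer–Saha: why `p ∤ c` is not assumed.) -/
theorem displaySwap_of_indexHalves_manin
    (W : WeierstrassCurve ℚ) [W.IsElliptic] [W.IsGloballyMinimal] (p : ℕ) [Fact p.Prime]
    (N : ℕ) [NeZero N] (K : Type) [Field K] [NumberField K]
    (Dt : ModularParametrizationData W N) (H : HeegnerDatum N (NumberField.discr K)) (ι : K →+* ℂ)
    (P : (W.baseChange K).toAffine.Point)
    (hGZ : gross_zagier N W K) (hKo : kolyvagin N W K)
    (hGZK : rank_eq_analyticRank_of_analyticRank_le_one) (hmod : hasEntireLFunction_rat)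
    (hK : IsImaginaryQuadratic K) (hlt : NumberField.discr K < -4)
    (hN : W.conductorNorm ℤ = N) (hHN : SatisfiesHeegnerHypothesis N K)
    (hHp : SatisfiesHeegnerHypothesis p K)
    (hP : WeierstrassCurve.Affine.Point.map ι.toRatAlgHom P = heegnerPointComplex Dt H)
    (hp5 : 5 ≤ p) (hr : W.analyticRank = 0)
    (Wd : WeierstrassCurve ℚ) [Wd.IsElliptic] [Wd.IsGloballyMinimal]
    (hWd : ∃ C : VariableChange ℚ, C • W.quadraticTwist (NumberField.discr K : ℚ) = Wd)
    (hrd : Wd.analyticRank = 1)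
    (hlo : SchneiderFree.IndexLowerBoundLeAt W p K P (padicValNat p Dt.c.natAbs))
    (hup : SchneiderFree.Upper.IndexUpperBoundLeAt W p K P (padicValNat p Dt.c.natAbs))
    (q qd : ℚ) (hq : W.entireLFunction 1 / (W.realPeriodRat : ℂ) = (q : ℂ))
    (hqd : Wd.leadingLCoeff / ((Wd.realPeriodRat * Wd.regulator : ℝ) : ℂ) = (qd : ℂ)) :
    padicValRat p q - ((padicValNat p W.shaOrder : ℤ) + padicValNat p W.tamagawaProduct -
        2 * padicValNat p W.torsionOrder) =
      -(padicValRat p qd - ((padicValNat p Wd.shaOrder : ℤ) + padicValNat p Wd.tamagawaProduct -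
        2 * padicValNat p Wd.torsionOrder)) := by
  have hpp : p.Prime := Fact.out
  have hp2 : p ≠ 2 := by omega
  haveI hEK : (W.baseChange K).IsElliptic := isElliptic_baseChange' W K
  have h2 : Module.finrank ℚ K = 2 := hK.1
  have hHN' : SatisfiesHeegnerHypothesis (W.conductorNorm ℤ) K := by rw [hN]; exact hHN
  have hD0 : (NumberField.discr K : ℚ) ≠ 0 := by exact_mod_cast NumberField.discr_ne_zero K
  haveI hEt : (W.quadraticTwist (NumberField.discr K : ℚ)).IsElliptic := W.isElliptic_quadraticTwist hD0
  obtain ⟨Cd, hCd⟩ := hWd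
  -- `p ∤ w_K = 2`, `ord_p u(Cd) = 0`
  have hμ : ¬ p ∣ Units.torsionOrder K := X2.not_dvd_unitsTorsionOrder_of_discr_lt hK hlt hpp hp2
  have hu : padicValRat p (Cd.u : ℚ) = 0 :=
    AdditivePotMult.padicValRat_u_eq_zero_of_twist_minimal_of_split W p K hK hHp Cd hCd
  ---------------------------------------------------------------- Kolyvagin: `Ш(E/K)` finite
  have hLt' : (W.quadraticTwist (NumberField.discr K : ℚ)).entireLFunction = Wd.entireLFunction := by
    rw [← hCd, entireLFunction_smul]
  have hL0d : Wd.entireLFunction 1 = 0 := entireLFunction_one_eq_zero_of_analyticRank_eq_one hrd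
  obtain ⟨-, hderivd⟩ := leadingLCoeff_eq_deriv_of_analyticRank_eq_one hrd
  have hLt0 : (W.quadraticTwist (NumberField.discr K : ℚ)).entireLFunction 1 = 0 := by
    rw [hLt']; exact hL0d
  have hprod : LDerivEK W K = W.entireLFunction 1 * deriv Wd.entireLFunction 1 := by
    rw [AdditivePotMult.lDerivEK_eq_mul_deriv W K hmod hLt0, hLt']
  have hLW : W.entireLFunction 1 ≠ 0 := (W.analyticRank_eq_zero_iff_holds (hmod W)).1 hr
  have hLK : LDerivEK W K ≠ 0 := by
    rw [hprod]; exact mul_ne_zero hLW hderivd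
  have hPH : IsHeegnerPoint N W K P := ⟨Dt, H, ι, hP⟩
  have hPinf : ¬ IsOfFinAddOrder P :=
    (lDerivEK_ne_zero_iff_not_isOfFinAddOrder W N K hGZ hK hHN hPH).mp hLK
  obtain ⟨-, hShaK⟩ := hKo hK hHN hPH hPinf
  haveI hfinK : Finite (W.baseChange K).sha := hShaK
  haveI hfinW : Finite W.sha := Literature.NumberTheory.EllipticCurves.shaFinite_of_baseChange W K hShaK
  obtain ⟨-, hShad⟩ := hGZK Wd (by omega)
  haveI hfinSd : Finite Wd.sha := hShad
  ---------------------------------------------------------------- the exact index over `K` at slack `v_p(c)`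
  have hKL := SchneiderFree.Upper.index_eq_of_lower_of_upper hlo hup
  ---------------------------------------------------------------- (5.6) `p`-adically, ranks exchanged (Manin constant kept)
  have h6 := TwistIdentity.padicValRat_add_eq_of_grossZagier_swap W p N K Dt H ι P hGZ hKo hGZK hmod hK
    hHN hP hp2 hμ hr Wd Cd hCd hu hrd q qd hq hqd
  ---------------------------------------------------------------- the odd parts under `K/ℚ`
  -- `Ш`: `v_p(#Ш(E/K)) = v_p(#Ш(E)) + v_p(#Ш(E^K))`
  have hsha : padicValNat p (W.baseChange K).shaOrder =
      padicValNat p W.shaOrder + padicValNat p Wd.shaOrder := by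
    have hcard := card_primaryComponent_sha_baseChange_quadratic_of_odd_of_finite W K h2 Wd
      ⟨Cd, hCd⟩ (W.baseChange K) ⟨1, one_smul _ _⟩ p hp2
    rw [WeierstrassCurve.shaOrder, WeierstrassCurve.shaOrder, WeierstrassCurve.shaOrder,
      ← (Nat.pow_right_injective hpp.two_le).eq_iff, pow_add,
      ← natCard_primaryComponent_eq_pow_padicValNat p, ← natCard_primaryComponent_eq_pow_padicValNat p,
      ← natCard_primaryComponent_eq_pow_padicValNat p]
    exact hcard
  -- torsion: `v_p(#E(K)_tors) = v_p(#E(ℚ)_tors) + v_p(#E^K(ℚ)_tors)`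
  obtain ⟨θ, c, hθ, hcθ⟩ := Quadratic.exists_sq_eq_algebraMap (F := ℚ) (K := K) h2
  obtain ⟨qq, hqq, hdq⟩ := NumberField.exists_discr_eq_mul_sq h2 hθ hcθ
  have htors : padicValNat p (W.baseChange K).torsionOrder =
      padicValNat p W.torsionOrder + padicValNat p Wd.torsionOrder :=
    AdditivePotMult.padicValNat_torsionOrder_baseChange_quadratic_anyRank W K h2 hθ hcθ hqq hdq Wd
      ⟨Cd, hCd⟩ p hp2
  -- Tamagawa: `v_p(∏c(E^K)) = v_p(∏c(E))` (parity-free in `d_K` for `p ≥ 5`)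
  have htam : padicValNat p Wd.tamagawaProduct = padicValNat p W.tamagawaProduct :=
    X11b.padicValNat_tamagawaProduct_twist_of_heegner W p hp5 K hK hHN' Cd hCd
  -- the parametrisation constant: the same valuation on both sides
  have hcz : (padicValInt p Dt.c : ℤ) = (padicValNat p Dt.c.natAbs : ℤ) := rfl
  ---------------------------------------------------------------- combine (the `2·v_p(c)` cancel)
  unfold SchneiderFree.IndexLowerBoundLeAt at hlo
  rw [hcz] at h6
  omega

end Display

/-! ## §2 `BSD_p` of the rank-one twist from a Kriz–Li datum of the stripped curve, print only -/

section Assembly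

open scoped MatrixGroups ModularForm

open CongruenceSubgroup WeierstrassCurve NumberField IsDedekindDomain
  Literature.NumberTheory.EllipticCurves
  Literature.NumberTheory.EllipticCurves.ModularForms
  Literature.NumberTheory.QuadraticFields
  Literature.NumberTheory.EllipticCurves.KrizLi2019
  Literature.NumberTheory.EllipticCurves.Rank1Residual
  Literature.NumberTheory.EllipticCurves.Rank1Residual.Typed
  Literature.NumberTheory.EllipticCurves.Wuthrich2014
  Literature.NumberTheory.EllipticCurves.SteinWuthrich2013
  Literature.NumberTheory.EllipticCurves.GreenbergVatsal2000
  Literature.NumberTheory.GaloisCohomology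
  Summit.BirchSwinnertonDyer.Rank1Residual
  Summit.BirchSwinnertonDyer.Rank1Residual.X12
  Summit.BirchSwinnertonDyer.BirchSwinnertonDyer.Theses
  Summit.BirchSwinnertonDyer.BirchSwinnertonDyer.Theses.UniversalToricDescent
  Summit.BirchSwinnertonDyer.BirchSwinnertonDyer.Theorems.Rank1ResidualX1RankZeroTwist
  Summit.BirchSwinnertonDyer.BirchSwinnertonDyer.Theorems.SchneiderFree
  Summit.BirchSwinnertonDyer.BirchSwinnertonDyer.Theorems.PrintCFram

variable {p : ℕ} [Fact p.Prime]

/-- **`BSD_p` OF THE RANK-ONE TWIST FROM A KRIZ–LI DATUM OF THE STRIPPED CURVE, FROM PRINT (the oriented kernel of the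
genus-internal branch; general `p`, Manin-robust).** The FOUR refereed named facts (Hsieh 2014 Thm. A, Liu–Zhang–Zhang 2018,
`ToricPublishedInputs`, Burungale–Flach 2024 Cor. 2 — the first conjunct of `stub_prints5` of registry v25) and Kriz–Li 2019 Thm. 1.20
give `BSDp W p` for every globally minimal `W/ℚ` with `W.analyticRank = 1` that is a model of the twist `V^{(d_K)}` of a globally
minimal `V/ℚ` with CM, `CMRamified V p`, `p ≥ 5`, by the discriminant of a Heegner field `K` OF `V` (`N = N_V`, `d_K < −4` of either parity)
carrying Heegner data `(Dt, H, ι, P)` and Kriz–Li's block AT `(V, K)` — `ψ` primitive, `ω` Teichmüller, the trace congruence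
`a_ℓ(V) ≡ ψ(ℓ) + ψ⁻¹ω(ℓ)`, (1) at `p`, (3) at the additive `ℓ ≠ p`, a Kronecker character `ε_K`, (4) the unit Bernoulli pair. NO
hypothesis on the analytic rank of `V` (it is `0`: Kriz–Li makes `P` non-torsion, so `L′(V/K,1) = L(V,1)·L′(W,1) ≠ 0`), NO Manin
hypothesis, NO separate Ш- or primitivity socket. Proof: frame (anticyclotomic `κ`, generator, degree-one `𝔭`); regularity of the frame
(`KrizLiLocusOfPrintsFour.exists_regular_of_krizLiBlock`); file 1's two index halves at `(V, K)`; `BSDp V p` in rank zero (CM: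
`bsdp_cm_rankZero`, Burungale–Flach); §1's display; bsd-eis's `bsdp_twist_of_displaySwap_of_bsdp_rankZero`. At `p = 7`, `V ∼ X₀(49)`,
`K = ℚ(√e*)` with `(e*/7) = +1`, `ψ = ω²`, (4) is `reg(e)·B_{1,ω}` — the card's branch for the classes with `χ_{e*}(7) = +1`.
CONDITIONAL on the named facts; BSD is not proved by any of this; no registered stub is closed.
[cite: KrizLi2019, Thm. 1.20 (pp. 7–8), Rem. 1.21 (p. 8)] [cite: CastellaGrossiLeeSkinner2022, proof of Thm. 5.3.1, (5.5)–(5.7)]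
[cite: GrossZagier1986, Thm. I.(6.3) and (7.3)] [cite: BurungaleFlach2024, Thm. 1.1 and Cor. 2] [cite: Miller2011LMS, Def. 1.1] -/
theorem bsdp_twist_of_strippedKrizLiDatum_of_prints
    (hprints : Hsieh2014.thmA_exists_isHsiehLFunction_unrPeriod_anyLevel ∧
      LiuZhangZhang2018.thm151_thm153_modularCurve_heegnerVector_additive ∧
      ToricPublishedInputs ∧
      bsdTriple_of_hasCM_of_L_one_ne_zero)
    (hKL : KrizLi2019.thm120_padicLogHeegner_unit_of_bernoulli)
    (V : WeierstrassCurve ℚ) [V.IsElliptic] [V.IsGloballyMinimal] (hCM : V.HasCM) (hram : CMRamified V p) (h5 : 5 ≤ p)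
    (N : ℕ) [NeZero N] (K : Type) [Field K] [NumberField K]
    (Dt : ModularParametrizationData V N) (H : HeegnerDatum N (NumberField.discr K)) (ι : K →+* ℂ)
    (P : (V.baseChange K).toAffine.Point)
    (hN : V.conductorNorm ℤ = N) (hK : IsImaginaryQuadratic K) (hHN : SatisfiesHeegnerHypothesis N K)
    (hd4 : NumberField.discr K < -4)
    (hP : WeierstrassCurve.Affine.Point.map ι.toRatAlgHom P = heegnerPointComplex Dt H)
    -- Kriz–Li's binders at `(V, p)`
    (f : ℕ) [NeZero f] (ψ : DirichletCharacter ℚ_[p] f) (ω : DirichletCharacter ℚ_[p] p)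
    (hψ : ψ.IsPrimitive) (hω : KrizLi2019.IsTeichmullerCharacter ω)
    (hss : ∀ ℓ : ℕ, ℓ.Prime → ¬ (ℓ ∣ p * V.conductorNorm ℤ) →
      ‖((V.LFunction ℓ : ℤ) : ℚ_[p]) - (ψ (ℓ : ZMod f) + ψ⁻¹ (ℓ : ZMod f) * ω (ℓ : ZMod p))‖ < 1)
    (h1 : ψ (p : ZMod f) ≠ 1) (h1' : KrizLi2019.primVal (KrizLi2019.invMulOmega ψ ω) p ≠ 1)
    (h3 : ∀ ℓ : ℕ, (hℓ : ℓ.Prime) → ℓ ≠ p →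
      (haveI := Fact.mk hℓ; ¬ V.HasGoodReductionAtPrime ℓ ∧ ¬ V.HasMultiplicativeReductionAtPrime ℓ) →
      ψ (ℓ : ZMod f) ≠ 1 ∧ KrizLi2019.primVal (KrizLi2019.invMulOmega ψ ω) ℓ ≠ 1)
    -- Kriz–Li's binders at `K`
    (εK : DirichletCharacter ℚ_[p] (NumberField.discr K).natAbs) (hεK : KrizLi2019.IsKroneckerCharacterOf K εK)
    (h4 : ¬ (‖KrizLi2019.bernoulliOnePrim (KrizLi2019.bernoulliCharOne ψ εK) *
        KrizLi2019.bernoulliOnePrim (KrizLi2019.bernoulliCharTwo ψ εK ω)‖ ≤ (p : ℝ)⁻¹))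
    -- the rank-one twist
    (W : WeierstrassCurve ℚ) [W.IsElliptic] [W.IsGloballyMinimal]
    (hW : ∃ C : VariableChange ℚ, C • V.quadraticTwist (NumberField.discr K : ℚ) = W) (hr : W.analyticRank = 1) :
    BSDp W p := by
  have hp : p.Prime := Fact.out
  have hp2 : p ≠ 2 := by omega
  have hprints7 := Theorems.PrintCFram.InputsPrints.prints7_of_prints4 hprints
  obtain ⟨hA, hL, hF, hPT2, hBF, hmod, -⟩ := hprints7
  obtain ⟨hGZ, hKo, hGZK, -, -, -, hGZ73, -, -, -⟩ := id hF
  have hadd : Addv V p := Theorems.PrintCFram.EisensteinResourceBdpLine.addv_of_cmRamified V hCM hram h5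
  have hpN : p ∣ N := by
    rw [← hN]; exact (V.dvd_conductorNorm_iff_not_hasGoodReductionAtPrime p).mpr hadd.1
  have hHp : SatisfiesHeegnerHypothesis p K := SatisfiesHeegnerHypothesis.of_dvd hpN hHN
  ---------------------------------------------------------------- the Heegner point is non-torsion (Kriz–Li Thm. 1.20)
  have h2 : ∀ ℓ : ℕ, (hℓ : ℓ.Prime) → ¬ (haveI := Fact.mk hℓ; V.HasSplitMultiplicativeReductionAtPrime ℓ) :=
    fun ℓ hℓ hsp ↦ by
      haveI := Fact.mk hℓ
      exact V.not_hasMultiplicativeReductionAtPrime_of_hasCM hCM ℓ hsp.hasMultiplicativeReductionAtPrime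
  have hnt : ¬ IsOfFinAddOrder P :=
    Theorems.PrintCFram.KrizLiLValueFree.not_isOfFinAddOrder_of_thm120 hKL hp2 V h2 N K Dt H ι P hN hK hHN hpN hP f ψ ω hψ hω
      hss h1 h1' h3 εK hεK h4
  ---------------------------------------------------------------- hence `r_an(V) = 0`
  have hD0 : (NumberField.discr K : ℚ) ≠ 0 := by exact_mod_cast NumberField.discr_ne_zero K
  haveI hEt : (V.quadraticTwist (NumberField.discr K : ℚ)).IsElliptic := V.isElliptic_quadraticTwist hD0
  obtain ⟨Cd, hCd⟩ := hW
  have hLt' : (V.quadraticTwist (NumberField.discr K : ℚ)).entireLFunction = W.entireLFunction := by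
    rw [← hCd, entireLFunction_smul]
  have hL0W : W.entireLFunction 1 = 0 := entireLFunction_one_eq_zero_of_analyticRank_eq_one hr
  have hLt0 : (V.quadraticTwist (NumberField.discr K : ℚ)).entireLFunction 1 = 0 := by
    rw [hLt']; exact hL0W
  have hprod : LDerivEK V K = V.entireLFunction 1 * deriv W.entireLFunction 1 := by
    rw [AdditivePotMult.lDerivEK_eq_mul_deriv V K hmod hLt0, hLt']
  have hLK : LDerivEK V K ≠ 0 :=
    (lDerivEK_ne_zero_iff_not_isOfFinAddOrder V N K (hGZ N V K) hK hHN ⟨Dt, H, ι, hP⟩).mpr hnt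
  have hLV : V.entireLFunction 1 ≠ 0 := by
    intro h0
    apply hLK
    rw [hprod, h0, zero_mul]
  have hrV : V.analyticRank = 0 := analyticRank_eq_zero_of_entireLFunction_one_ne_zero V hLV
  ---------------------------------------------------------------- a frame and its regularity (class-agnostic)
  have himag : ∀ w : InfinitePlace K, w.IsComplex := fun w ↦ hK.2.isComplex w
  obtain ⟨κ, hκ⟩ := ZpExtension.exists_isAnticyclotomic_holds (K := K) (p := p) hK.1 himag
  obtain ⟨γ, hγ⟩ := κ.exists_isTopGenerator
  haveI hγF : Fact (κ.IsTopGenerator γ) := ⟨hγ⟩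
  obtain ⟨𝔭, h𝔭⟩ := Literature.NumberTheory.NumberFields.RingOfIntegers.exists_heightOneSpectrum_natCast_mem K hp
  obtain ⟨he, hf⟩ := UniversalToricDescentStrictPlace.degreeOne_of_dvd_of_heegner hK hHN hpN h𝔭
  have hreg := Theorems.PrintCFram.KrizLiLocusOfPrintsFour.exists_regular_of_krizLiBlock V hCM hram h5 N K f ψ ω εK hN hK hHN
    hψ hω hss hεK h4 κ γ hγ 𝔭 h𝔭 he hf
  ---------------------------------------------------------------- both index halves at `(V, K)`, slack `v_p(c)`
  obtain ⟨hlo, hupI⟩ := indexHalves_cmRamified_of_regularKrizLiDatum' hA hL hPT2 hKo hKL V hCM hram h5 N K Dt H ι P hN hK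
    hHN hd4 hP hnt f ψ ω hψ hω hss h1 h1' h3 εK hεK h4 κ hκ γ 𝔭 h𝔭 hreg
  ---------------------------------------------------------------- `BSD_p(V)` in rank zero (CM: Burungale–Flach)
  have hBV : BSDp V p := bsdp_cm_rankZero hBF hmod hCM hrV
  ---------------------------------------------------------------- the swapped display, then bsd-eis's swap upwards
  have hdisp : ∀ (q qd : ℚ), V.entireLFunction 1 / (V.realPeriodRat : ℂ) = (q : ℂ) →
      W.leadingLCoeff / ((W.realPeriodRat * W.regulator : ℝ) : ℂ) = (qd : ℂ) →
      padicValRat p q - ((padicValNat p V.shaOrder : ℤ) + padicValNat p V.tamagawaProduct -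
          2 * padicValNat p V.torsionOrder) =
        -(padicValRat p qd - ((padicValNat p W.shaOrder : ℤ) + padicValNat p W.tamagawaProduct -
          2 * padicValNat p W.torsionOrder)) :=
    fun q qd hq hqd ↦ displaySwap_of_indexHalves_manin V p N K Dt H ι P (hGZ N V K) (hKo N V K) hGZK hmod hK hd4 hN hHN
      hHp hP h5 hrV W ⟨Cd, hCd⟩ hr hlo hupI q qd hq hqd
  exact EisensteinPrimesMazurMCOnCellBTwistbackDefectSwapUp.bsdp_twist_of_displaySwap_of_bsdp_rankZero hmod hGZK hGZ73 V p hrV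
    hBV W hr hdisp

end Assembly

end Summit.BirchSwinnertonDyer.BirchSwinnertonDyer.Theorems.PrintCFram.GenusInternal

end
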